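import Mathlib
import Literature.Computability.AlgebraicComplexity.AsymptoticSpectrum
import Literature.Computability.AlgebraicComplexity.AsymptoticRankZariskiClosedProofs

-- (imports Literature only: the piece is copied verbatim below, so this file elaborates independently of the
-- route file's revision; the route decl `HesseHammingShells.<Piece>` unfolds to the local copy.)

/-!
# Birth skeleton for the crux `SignedTableGeneric` (stmt-MatrixMultiplication-17614) — line "transcendental anchor on the Hesse pencil"

`SignedTableGeneric`: `∀ s, R̃(T_s) ≤ R̃(T_{-1})` for the Hesse pencil
`T_s(x,y,z) = [x+y+z=0]·(1 if x=y else s)` — the parameter `−1` is not exceptional.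

Line. Three lemmas, two of them theorem-grade:
* `stub_pencilSublevelFiniteOrAll` (M, given the tree): for every `r`, the sublevel set
  `{s : R̃(T_s) ≤ r}` is finite or all of `ℂ` — CHNVZ 2025 Thm 1.2 is PROVED in tree
  (`chnvz_zariskiClosed_asymptoticRank_le_holds`: `{t : R̃(t) ≤ r}` is the zero set of polynomials)
  and `s ↦ T_s` is affine-linear in `s`, so the pull-back is the zero set of univariate polynomials.
* `stub_transcendentalClassInfinite` (M/L): the level set of a TRANSCENDENTAL parameter `τ` is
  infinite — `Aut(ℂ)` acts transitively on transcendental numbers (extend `ℚ(τ) ≅ ℚ(τ')` through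
  transcendence bases), `T_{σ s} = σ ∘ T_s` entrywise (entries `0, 1, s`) and tensor rank of every
  Kronecker power is invariant under a ring automorphism applied entrywise, so all (uncountably
  many) transcendental `τ'` have `R̃(T_{τ'}) = R̃(T_τ)`.
* `stub_signedAnchored` (THE CONTENT, XL): `−1` has the asymptotic rank of SOME transcendental
  parameter — "no drop of `R̃` at the algebraic generic-orbit point `−1`" (its `A₄`-orbit
  `{−μ₃, −2μ₃, …}` has trivial extra stabiliser). Refutable by a universal spectral point with
  `F(T_{-1}) < F(T_τ)`; supportable degree by degree (`bR(T_{-1}^{⊠N})` = generic value, `N ≤ 3`,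
  Koszul-flattening kit jobs).
Composition `SignedTableGeneric_of` (kernel-checked; sorries only in the three stubs): with `τ`
from the anchor and `r := R̃(T_τ)`, the sublevel set `{s : R̃(T_s) ≤ r}` contains the infinite level
set of `τ`, hence is all of `ℂ`; so `R̃(T_s) ≤ R̃(T_τ) = R̃(T_{-1})`.
-/

set_option linter.dupNamespace false

namespace Summit.MatrixMultiplication.MatrixMultiplication.Cruxes.SignedTableGeneric.TranscendentalAnchor

open Literature.Computability.AlgebraicComplexity

/-- The Hesse pencil member `T_s` (local abbreviation; unfolds to the route's inline lambda). -/
def hesse (s : ℂ) : Fin 3 → Fin 3 → Fin 3 → ℂ :=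
  fun x y z : Fin 3 => if x + y + z = 0 then (if x = y then (1 : ℂ) else s) else 0

/-- The crux, verbatim (the route decl `HesseHammingShells.SignedTableGeneric` unfolds to this). -/
def SignedTableGeneric : Prop :=
  ∀ s : ℂ, Literature.Computability.AlgebraicComplexity.asymptoticRank (fun x y z : Fin 3 => if x + y + z = 0 then (if x = y then (1 : ℂ) else s) else 0) ≤ Literature.Computability.AlgebraicComplexity.asymptoticRank (fun x y z : Fin 3 => if x + y + z = 0 then (if x = y then (1 : ℂ) else (-1 : ℂ)) else 0)

/-- STUB 1 (theorem-grade, size M given CHNVZ in tree): sublevel sets of `s ↦ R̃(T_s)` are finite or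
everything (Zariski-closed subsets of the affine line). -/
theorem stub_pencilSublevelFiniteOrAll :
    ∀ r : ℝ, {s : ℂ | asymptoticRank (hesse s) ≤ r}.Finite ∨ {s : ℂ | asymptoticRank (hesse s) ≤ r} = Set.univ := by
  sorry

/-- STUB 2 (theorem-grade, size M/L): the level set of a transcendental parameter is infinite
(`Aut(ℂ)`-transitivity on transcendentals + automorphism invariance of `R̃ ∘ hesse`). -/
theorem stub_transcendentalClassInfinite :
    ∀ τ : ℂ, Transcendental ℚ τ → {s : ℂ | asymptoticRank (hesse s) = asymptoticRank (hesse τ)}.Infinite := by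
  sorry

/-- STUB 3 (the content, size XL): the signed table is anchored to a transcendental (= generic)
member: `R̃(T_{-1}) = R̃(T_τ)` for some transcendental `τ`. -/
theorem stub_signedAnchored :
    ∃ τ : ℂ, Transcendental ℚ τ ∧ asymptoticRank (hesse (-1)) = asymptoticRank (hesse τ) := by
  sorry

/-- COMPOSITION (kernel-checked): finite-or-all sublevel sets + infinite transcendental level sets +
the anchor give domination of every member by `T_{-1}`. -/
theorem SignedTableGeneric_of
    (h₁ : ∀ r : ℝ, {s : ℂ | asymptoticRank (hesse s) ≤ r}.Finite ∨ {s : ℂ | asymptoticRank (hesse s) ≤ r} = Set.univ)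
    (h₂ : ∀ τ : ℂ, Transcendental ℚ τ → {s : ℂ | asymptoticRank (hesse s) = asymptoticRank (hesse τ)}.Infinite)
    (h₃ : ∃ τ : ℂ, Transcendental ℚ τ ∧ asymptoticRank (hesse (-1)) = asymptoticRank (hesse τ)) :
    SignedTableGeneric := by
  obtain ⟨τ, hτ, hanchor⟩ := h₃
  intro s
  -- the sublevel set at the level of `τ` contains the (infinite) level set of `τ`, so it is everything
  have hsub : {s' : ℂ | asymptoticRank (hesse s') = asymptoticRank (hesse τ)} ⊆
      {s' : ℂ | asymptoticRank (hesse s') ≤ asymptoticRank (hesse τ)} := fun s' hs' => le_of_eq hs'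
  have hall : {s' : ℂ | asymptoticRank (hesse s') ≤ asymptoticRank (hesse τ)} = Set.univ := by
    rcases h₁ (asymptoticRank (hesse τ)) with hfin | hall
    · exact absurd (hfin.subset hsub) (h₂ τ hτ)
    · exact hall
  have hs : s ∈ {s' : ℂ | asymptoticRank (hesse s') ≤ asymptoticRank (hesse τ)} := hall ▸ Set.mem_univ s
  change asymptoticRank (hesse s) ≤ asymptoticRank (hesse (-1))
  rw [hanchor]
  exact hs

/-- The skeleton closes the crux from its stubs. -/
theorem SignedTableGeneric_of_stubs : SignedTableGeneric :=
  SignedTableGeneric_of stub_pencilSublevelFiniteOrAll stub_transcendentalClassInfinite stub_signedAnchored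

end Summit.MatrixMultiplication.MatrixMultiplication.Cruxes.SignedTableGeneric.TranscendentalAnchor
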